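import Summits.ValiantsHypothesis.ValiantsHypothesis.Theorems.KPlusLogSqLawTropicalSymmetricOrbitThreeFourPairsDD
import Summits.ValiantsHypothesis.ValiantsHypothesis.Theorems.KPlusLogSqLawTropicalOrbitChainAbstract

/-!
# Route «KPlusLogSqLaw» — the symmetric `(3,4)` tropical row in the ORBIT model: `T^orb_sym(3,4) ≤ 18` ON EVERY SUPPORT
# (`TropRootLawAtSymmOrb 3 4 18` — the orbit-model analogue of p459728, face-free)

HONEST FRAMING.  Helper file (seat val-sym-lift-p2 (g6), cell `pub-symmetroid`, 2026-08-27; `--supports` the `WeakLifting` item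
stmt-ValiantsHypothesis-19561 as a helper, no closure claim).  A SMALL-FORMAT statement in the transpose-ORBIT carrier model of the tree
(`IsOrbitDominant`: a term beats every present term outside its transpose orbit; the cell's five-type / patchwork model), far inside the known
regime of the cruxes; a tropical count constrains Viro-type constructions only, not real pencils.  The orbit targets of record are
`TSymOrb34Le17` (pre-registered words R1732) and `TSymOrb34Le16` (cell value, two codes) — NOT claimed here; this file is the first kernel row
of the orbit model, `≤ 18`.  Nothing on `TropicalB` / `WeakLifting` in their windows, Conjecture B, DoorA34 = `PosRootLawAt 3 4 18` (OPEN, never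
asserted), `MatrixDescartes` (stmt-ValiantsHypothesis-18050) or VP ≠ VNP.

PROOF (face-free).  Rank coordinates via the sorting bijection (`…TropicalOrbitChainAbstract`).  ORBIT LEMMA Y (`orbY`): no alternating orbit
chain carries all four of `{0,1,3}, {0,2,3}, {1,1,2}, {1,2,2}` — by carrier type: a pair carrier on `{0,1,3}` or `{0,2,3}` excludes identity
terms (`C_extreme_D`) and pair carriers on `{1,1,2}`/`{1,2,2}` (`CC_low_high`), and with two transposition terms it is `K3`; two identity terms
with a pair carrier on `{1,1,2}` / `{1,2,2}` is `K1` / `K2`; the all-`D/T` case is the single-term Lemma Y (`orbY1` + `orbY2`, `g 1 ≤ g 2`).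
Hence one of the twenty rank multisets is always missed: `n + 1 ≤ 19`.
[cell statement R1732; folklore-level exchange arguments, no citation exists]
-/

set_option linter.dupNamespace false
set_option autoImplicit false

namespace Summit.ValiantsHypothesis.ValiantsHypothesis.Theorems.KPlusLogSqLaw

open Summit.ValiantsHypothesis.ValiantsHypothesis.Theorems.MatrixDescartes.Negative
open Summit.ValiantsHypothesis.ValiantsHypothesis.Theorems.LacunarySymmetroidMatrixDescartes
open Summit.ValiantsHypothesis.ValiantsHypothesis.Theorems.LacunarySymmetroidMatrixDescartes.TropicalCensus
open Finset

namespace SymmetricOrbitThreeFour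

open SymmetricThreeFour SymmetricThreeFourSeventeen SymmetricThreeFourSixteen SymmetricThreeFourFifteen

/-- a term with three distinct ranks is not a transposition term with equal ranks on its pair. -/
theorem not_swap_of_counts_le_one {n : ℕ} (r : Fin (n + 1) → Equiv.Perm (Fin 3) × (Fin 3 → Fin 4)) (a : Fin (n + 1))
    (hle : ∀ l, (univ.filter fun t => (r a).2 t = l).card ≤ 1) :
    ¬ ∃ i j : Fin 3, i < j ∧ (r a).1 = Equiv.swap i j ∧ (r a).2 i = (r a).2 j := by
  rintro ⟨i, j, hij, -, hcc⟩
  have h2 := two_le_card_filter (r a) (ne_of_lt hij).symm hcc.symm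
  have := hle ((r a).2 i)
  omega

/-- **ORBIT LEMMA Y.**  Under the orbit-chain hypotheses, `{0,1,3}, {0,2,3}, {1,1,2}, {1,2,2}` are not all carried. [case tree of the cell's
blueprint §6: `C_extreme_D`, `CC_low_high`, `K3`, `K1`, `K2`, `orbY1`, `orbY2`] -/
theorem orbY {n : ℕ} (r : Fin (n + 1) → Equiv.Perm (Fin 3) × (Fin 3 → Fin 4)) (g : Fin 4 → ℕ) (hmono : Monotone g)
    (hshape : ∀ k, (r k).1 = 1 ∨ (∃ i j : Fin 3, i < j ∧ (r k).1 = Equiv.swap i j ∧ (r k).2 i = (r k).2 j) ∨ (∀ i, (r k).1 i ≠ i))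
    (hM : ∀ a b : Fin (n + 1), a < b → ∀ l₁ l₂ : Fin 3,
      ((r a).1 l₁ = (r b).1 l₂ ∧ l₁ = l₂) ∨ ((r a).1 l₁ = l₂ ∧ (r b).1 l₂ = l₁) → (r a).2 l₁ ≤ (r b).2 l₂)
    (hR1 : ∀ a b : Fin (n + 1), a < b → (r a).1 = 1 → ∀ i j : Fin 3, i ≠ j → (r b).1 = Equiv.swap i j → (r b).2 i = (r b).2 j →
      g ((r a).2 i) + g ((r a).2 j) < 2 * g ((r b).2 i))
    (hR1' : ∀ a b : Fin (n + 1), a < b → (r b).1 = 1 → ∀ i j : Fin 3, i ≠ j → (r a).1 = Equiv.swap i j → (r a).2 i = (r a).2 j →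
      2 * g ((r a).2 i) < g ((r b).2 i) + g ((r b).2 j))
    (hR2 : ∀ a b : Fin (n + 1), a < b → ∀ i j k : Fin 3, i ≠ j → k ≠ i → k ≠ j → (r a).1 = Equiv.swap i j →
      (r a).2 i = (r a).2 j → (r b).1 i = j → (r b).1 j = k → (r b).1 k = i →
      g ((r a).2 k) + g ((r a).2 i) < g ((r b).2 j) + g ((r b).2 k))
    (hR2' : ∀ a b : Fin (n + 1), a < b → ∀ i j k : Fin 3, i ≠ j → k ≠ i → k ≠ j → (r a).1 i = j → (r a).1 j = k → (r a).1 k = i →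
      (r b).1 = Equiv.swap i j → (r b).2 i = (r b).2 j → g ((r a).2 j) + g ((r a).2 k) < g ((r b).2 k) + g ((r b).2 i))
    (hR3 : ∀ a b : Fin (n + 1), a < b → (r a).1 = 1 → ∀ i j k : Fin 3, i ≠ j → k ≠ i → k ≠ j →
      (r b).1 i = j → (r b).1 j = k → (r b).1 k = i → g ((r a).2 i) + g ((r a).2 j) < 2 * g ((r b).2 i))
    (hR3' : ∀ a b : Fin (n + 1), a < b → (r b).1 = 1 → ∀ i j k : Fin 3, i ≠ j → k ≠ i → k ≠ j →
      (r a).1 i = j → (r a).1 j = k → (r a).1 k = i → 2 * g ((r a).2 i) < g ((r b).2 i) + g ((r b).2 j))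
    (a b c e : Fin (n + 1))
    (ha : TropicalCensus.classSym (r a) = TropicalCensus.classSym ((1 : Equiv.Perm (Fin 3)), (![0, 1, 3] : Fin 3 → Fin 4)))
    (hb : TropicalCensus.classSym (r b) = TropicalCensus.classSym ((1 : Equiv.Perm (Fin 3)), (![0, 2, 3] : Fin 3 → Fin 4)))
    (hc : TropicalCensus.classSym (r c) = TropicalCensus.classSym ((1 : Equiv.Perm (Fin 3)), (![1, 1, 2] : Fin 3 → Fin 4)))
    (he : TropicalCensus.classSym (r e) = TropicalCensus.classSym ((1 : Equiv.Perm (Fin 3)), (![1, 2, 2] : Fin 3 → Fin 4))) : False := by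
  have ca : ∀ l, (univ.filter fun t => (r a).2 t = l).card = (![1, 1, 0, 1] : Fin 4 → ℕ) l :=
    fun l => (card_filter_eq_of_classSym_eq ha l).trans (cnt013 l)
  have cb : ∀ l, (univ.filter fun t => (r b).2 t = l).card = (![1, 0, 1, 1] : Fin 4 → ℕ) l :=
    fun l => (card_filter_eq_of_classSym_eq hb l).trans (cnt023 l)
  have cc : ∀ l, (univ.filter fun t => (r c).2 t = l).card = (![0, 2, 1, 0] : Fin 4 → ℕ) l :=
    fun l => (card_filter_eq_of_classSym_eq hc l).trans (cnt112 l)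
  have ce : ∀ l, (univ.filter fun t => (r e).2 t = l).card = (![0, 1, 2, 0] : Fin 4 → ℕ) l :=
    fun l => (card_filter_eq_of_classSym_eq he l).trans (cnt122 l)
  obtain ⟨a0, ha0⟩ := exists_of_card_pos ((r a).2) 0 (by rw [ca 0]; decide)
  obtain ⟨a3, ha3⟩ := exists_of_card_pos ((r a).2) 3 (by rw [ca 3]; decide)
  obtain ⟨b0, hb0⟩ := exists_of_card_pos ((r b).2) 0 (by rw [cb 0]; decide)
  obtain ⟨b3, hb3⟩ := exists_of_card_pos ((r b).2) 3 (by rw [cb 3]; decide)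
  have c_lo : ∀ l, (r c).2 l ≠ 0 := ne_of_card_zero _ 0 (by rw [cc 0]; rfl)
  have c_hi : ∀ l, (r c).2 l ≠ 3 := ne_of_card_zero _ 3 (by rw [cc 3]; rfl)
  have e_lo : ∀ l, (r e).2 l ≠ 0 := ne_of_card_zero _ 0 (by rw [ce 0]; rfl)
  have e_hi : ∀ l, (r e).2 l ≠ 3 := ne_of_card_zero _ 3 (by rw [ce 3]; rfl)
  have hashape : (r a).1 = 1 ∨ ∀ i, (r a).1 i ≠ i := by
    rcases hshape a with h | h | h
    · exact Or.inl h
    · exact absurd h (not_swap_of_counts_le_one r a fun l => by rw [ca l]; fin_cases l <;> decide)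
    · exact Or.inr h
  have hbshape : (r b).1 = 1 ∨ ∀ i, (r b).1 i ≠ i := by
    rcases hshape b with h | h | h
    · exact Or.inl h
    · exact absurd h (not_swap_of_counts_le_one r b fun l => by rw [cb l]; fin_cases l <;> decide)
    · exact Or.inr h
  rcases hashape with ha1 | haC
  · rcases hbshape with hb1 | hbC
    · -- two identity terms
      rcases hshape c with hc1 | hcT | hcC
      · rcases hshape e with he1 | heT | heC
        · have y1 := orbY1 r g hmono hM hR1 hR1' a c ha1 ha hc (Or.inl hc1)
          have y2 := orbY2 r g hmono hM hR1 hR1' b e hb1 hb he (Or.inl he1)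
          have g12 : g 1 ≤ g 2 := hmono (by decide)
          omega
        · have y1 := orbY1 r g hmono hM hR1 hR1' a c ha1 ha hc (Or.inl hc1)
          have y2 := orbY2 r g hmono hM hR1 hR1' b e hb1 hb he (Or.inr heT)
          have g12 : g 1 ≤ g 2 := hmono (by decide)
          omega
        · exact K2 r g hmono hM hR3 hR3' a b e ha1 hb1 heC ha hb he
      · rcases hshape e with he1 | heT | heC
        · have y1 := orbY1 r g hmono hM hR1 hR1' a c ha1 ha hc (Or.inr hcT)
          have y2 := orbY2 r g hmono hM hR1 hR1' b e hb1 hb he (Or.inl he1)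
          have g12 : g 1 ≤ g 2 := hmono (by decide)
          omega
        · have y1 := orbY1 r g hmono hM hR1 hR1' a c ha1 ha hc (Or.inr hcT)
          have y2 := orbY2 r g hmono hM hR1 hR1' b e hb1 hb he (Or.inr heT)
          have g12 : g 1 ≤ g 2 := hmono (by decide)
          omega
        · exact K2 r g hmono hM hR3 hR3' a b e ha1 hb1 heC ha hb he
      · exact K1 r g hmono hM hR3 hR3' a b c ha1 hb1 hcC ha hb hc
    · exact C_extreme_D r g hmono hR3 hR3' a b ha1 hbC b0 b3 hb0 hb3
  · -- `{0,1,3}` on a pair carrier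
    rcases hshape c with hc1 | ⟨i, j, hij, hcs, hcc⟩ | hcC
    · exact C_extreme_D r g hmono hR3 hR3' c a hc1 haC a0 a3 ha0 ha3
    · rcases hshape e with he1 | ⟨i', j', hij', hes, hee⟩ | heC
      · exact C_extreme_D r g hmono hR3 hR3' e a he1 haC a0 a3 ha0 ha3
      · exact K3 r g hmono hM hR2 hR2' a c e haC ha hc he hij hcs hcc hij' hes hee
      · exact CC_low_high r hM e a heC haC e_lo e_hi a0 a3 ha0 ha3
    · exact CC_low_high r hM c a hcC haC c_lo c_hi a0 a3 ha0 ha3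

/-- **CORE (face-free), orbit model, eighteen.**  Under the orbit-chain hypotheses with pairwise distinct rank multisets, `n ≤ 18`.
[orbY + counting] -/
theorem core18 (n : ℕ) (r : Fin (n + 1) → Equiv.Perm (Fin 3) × (Fin 3 → Fin 4)) (g : Fin 4 → ℕ) (hmono : Monotone g)
    (hshape : ∀ k, (r k).1 = 1 ∨ (∃ i j : Fin 3, i < j ∧ (r k).1 = Equiv.swap i j ∧ (r k).2 i = (r k).2 j) ∨ (∀ i, (r k).1 i ≠ i))
    (hM : ∀ a b : Fin (n + 1), a < b → ∀ l₁ l₂ : Fin 3,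
      ((r a).1 l₁ = (r b).1 l₂ ∧ l₁ = l₂) ∨ ((r a).1 l₁ = l₂ ∧ (r b).1 l₂ = l₁) → (r a).2 l₁ ≤ (r b).2 l₂)
    (h3 : Function.Injective fun k => TropicalCensus.classSym (r k))
    (hR1 : ∀ a b : Fin (n + 1), a < b → (r a).1 = 1 → ∀ i j : Fin 3, i ≠ j → (r b).1 = Equiv.swap i j → (r b).2 i = (r b).2 j →
      g ((r a).2 i) + g ((r a).2 j) < 2 * g ((r b).2 i))
    (hR1' : ∀ a b : Fin (n + 1), a < b → (r b).1 = 1 → ∀ i j : Fin 3, i ≠ j → (r a).1 = Equiv.swap i j → (r a).2 i = (r a).2 j →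
      2 * g ((r a).2 i) < g ((r b).2 i) + g ((r b).2 j))
    (hR2 : ∀ a b : Fin (n + 1), a < b → ∀ i j k : Fin 3, i ≠ j → k ≠ i → k ≠ j → (r a).1 = Equiv.swap i j →
      (r a).2 i = (r a).2 j → (r b).1 i = j → (r b).1 j = k → (r b).1 k = i →
      g ((r a).2 k) + g ((r a).2 i) < g ((r b).2 j) + g ((r b).2 k))
    (hR2' : ∀ a b : Fin (n + 1), a < b → ∀ i j k : Fin 3, i ≠ j → k ≠ i → k ≠ j → (r a).1 i = j → (r a).1 j = k → (r a).1 k = i →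
      (r b).1 = Equiv.swap i j → (r b).2 i = (r b).2 j → g ((r a).2 j) + g ((r a).2 k) < g ((r b).2 k) + g ((r b).2 i))
    (hR3 : ∀ a b : Fin (n + 1), a < b → (r a).1 = 1 → ∀ i j k : Fin 3, i ≠ j → k ≠ i → k ≠ j →
      (r b).1 i = j → (r b).1 j = k → (r b).1 k = i → g ((r a).2 i) + g ((r a).2 j) < 2 * g ((r b).2 i))
    (hR3' : ∀ a b : Fin (n + 1), a < b → (r b).1 = 1 → ∀ i j k : Fin 3, i ≠ j → k ≠ i → k ≠ j →
      (r a).1 i = j → (r a).1 j = k → (r a).1 k = i → 2 * g ((r a).2 i) < g ((r b).2 i) + g ((r b).2 j)) : n ≤ 18 := by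
  by_contra hn
  rw [not_le] at hn
  have hcard := Fintype.card_le_of_injective _ h3
  rw [Fintype.card_fin, Sym.card_sym_eq_multichoose, Fintype.card_fin] at hcard
  have h20 : Nat.multichoose 4 3 = 20 := by rw [Nat.multichoose_eq]; rfl
  obtain rfl : n = 19 := by omega
  have hsurj : ∀ M : Sym (Fin 4) 3, ∃ k : Fin (19 + 1), TropicalCensus.classSym (r k) = M := by
    have hbij : Function.Bijective fun k : Fin (19 + 1) => TropicalCensus.classSym (r k) := by
      rw [Fintype.bijective_iff_injective_and_card]
      refine ⟨h3, ?_⟩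
      rw [Fintype.card_fin, Sym.card_sym_eq_multichoose, Fintype.card_fin, h20]
    exact fun M => hbij.2 M
  obtain ⟨a, ha⟩ := hsurj (TropicalCensus.classSym ((1 : Equiv.Perm (Fin 3)), (![0, 1, 3] : Fin 3 → Fin 4)))
  obtain ⟨b, hb⟩ := hsurj (TropicalCensus.classSym ((1 : Equiv.Perm (Fin 3)), (![0, 2, 3] : Fin 3 → Fin 4)))
  obtain ⟨c, hc⟩ := hsurj (TropicalCensus.classSym ((1 : Equiv.Perm (Fin 3)), (![1, 1, 2] : Fin 3 → Fin 4)))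
  obtain ⟨e, he⟩ := hsurj (TropicalCensus.classSym ((1 : Equiv.Perm (Fin 3)), (![1, 2, 2] : Fin 3 → Fin 4)))
  exact orbY r g hmono hshape hM hR1 hR1' hR2 hR2' hR3 hR3' a b c e ha hb hc he

end SymmetricOrbitThreeFour

open SymmetricOrbitThreeFour
open Summit.ValiantsHypothesis.ValiantsHypothesis.Theorems.LacunarySymmetroidMatrixDescartes.TropicalCensus.Orbit

/-- **`T^orb_sym(3,4) ≤ 18` ON EVERY SUPPORT.**  A SYMMETRIC `3 × 3` dominance design with four slope classes has at most `18` sign-alternating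
ORBIT-dominant breakpoints along increasing integer slopes (orbit model: a term beats every present term outside its transpose orbit — the
cell's five-type model with pair carriers).  Face-free: the orbit Lemma Y (`orbY`) shows one of the twenty rank multisets is always missed.
The orbit analogue of p459728; the targets `TSymOrb34Le17` (pairwise, sign-free per the cell census) and `TSymOrb34Le16` (cell value) remain open
in the kernel. [cell statement R1732; folklore-level exchange arguments] -/
theorem tropRow_three_four_symmOrb_le_eighteen (d : Fin 4 → ℕ) (v ε : Fin 3 → Fin 3 → Fin 4 → ℤ)
    (hv : ∀ i j l, v i j l = v j i l) (hεs : ∀ i j l, ε i j l = ε j i l)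
    (n : ℕ) (θ : Fin (n + 1) → ℤ) (p : Fin (n + 1) → Equiv.Perm (Fin 3) × (Fin 3 → Fin 4))
    (hθ : StrictMono θ) (hdom : ∀ k, IsOrbitDominant d v ε (θ k) (p k))
    (halt : ∀ k : Fin n, termSign ε (p k.castSucc) * termSign ε (p k.succ) < 0) : n ≤ 18 :=
  SymmetricOrbitThreeFour.core18 n (fun k => ((p k).1, fun i => (Tuple.sort d).symm ((p k).2 i))) (d ∘ Tuple.sort d)
    (Tuple.monotone_sort d)
    (fun k => orbitChain_shape d v ε hv hεs θ p hdom k)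
    (fun a b hab l₁ l₂ hcell => orbitChain_M d v ε hv hεs θ p hθ hdom a b hab l₁ l₂ hcell)
    (orbitChain_injective d v ε hv hεs θ p hθ hdom halt)
    (fun a b hab ha1 _ _ hij hb1 hcc => orbitChain_R1 d v ε θ p hθ hdom a b hab ha1 hij hb1 hcc)
    (fun a b hab hb1 _ _ hij ha1 hcc => orbitChain_R1' d v ε θ p hθ hdom a b hab hb1 hij ha1 hcc)
    (fun a b hab _ _ _ hij hki hkj ha1 hcc hbi hbj hbk => orbitChain_R2 d v ε hv hεs θ p hθ hdom a b hab hij hki hkj ha1 hcc hbi hbj hbk)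
    (fun a b hab _ _ _ hij hki hkj hai haj hak hb1 hcc => orbitChain_R2' d v ε hv hεs θ p hθ hdom a b hab hij hki hkj hai haj hak hb1 hcc)
    (fun a b hab ha1 _ _ _ hij hki hkj hbi hbj hbk => orbitChain_R3 d v ε hv hεs θ p hθ hdom a b hab ha1 hij hki hkj hbi hbj hbk)
    (fun a b hab hb1 _ _ _ hij hki hkj hai haj hak => orbitChain_R3' d v ε hv hεs θ p hθ hdom a b hab hb1 hij hki hkj hai haj hak)

/-- **`TropRootLawAtSymmOrb 3 4 18`** — the first kernel row of the ORBIT model at `(3,4)` (targets of record: `17`, `16`). [restatement] -/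
theorem tropRootLawAtSymmOrb_three_four_eighteen : TropRootLawAtSymmOrb 3 4 18 :=
  fun d v ε hv hε n θ p hθ hdom halt => tropRow_three_four_symmOrb_le_eighteen d v ε hv hε n θ p hθ hdom halt

end Summit.ValiantsHypothesis.ValiantsHypothesis.Theorems.KPlusLogSqLaw
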